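import Summits.KontsevichZagierPeriods.KontsevichZagierPeriods.Theorems.LinRedNormalFormArrangementNormalFormSeparateAllHHExact
import Summits.KontsevichZagierPeriods.KontsevichZagierPeriods.Theorems.LinRedNormalFormArrangementNormalFormSeparateAllHHNest
import Summits.KontsevichZagierPeriods.KontsevichZagierPeriods.Theorems.LinRedNormalFormArrangementNormalFormSeparateAllHHMonoSplit

/-!
# The numerator along a nested sector of any depth: frame polynomials and tensors

(Line `janus-bands`, crux `ArrangementNormalForm`, stub `stub_separateHigh_hH`, part `AllHHForms` of
the dimension-generic wall-invariant termwise-split lemma, base dimension `b + 1 ≥ 4` with fibres;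
namespace `SepAll`.)
The numerator of a terminal piece over the base `ℝ^{b+1}` is `∑_{i<N} q_i(x′) λ(x)^i` with
`x′ = pr x` and the pole coordinate `λ(x) = x_b − (∑ l_i x_i + l₀)` (`lam`, linear part `lamL`);
the Taylor pieces are its terms. At a base point `z₁` with frame `f` (frame point
`fpt z₁ f s = z₁ + ∑ s_l • f_l`, frame coordinates `s`), provided the frame vector `f l₀'` is
VERTICAL (`pr (f l₀') = 0`), they become honest polynomials in `s`: `Gpiece i = Lpoly^i · Kpoly (q i)`
with the affine pole polynomial `Lpoly` and coefficients `Kpoly (q i)` FREE OF `X_{l₀'}`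
(`eval_Gpiece`, `support_Kpoly`). Along the nested sector `s = cum w` every frame monomial `s^γ` is
the blown-up monomial `w^{Mex γ}` (`prod_cum_pow`; `Mex` injective), so frame polynomials have
coefficient TENSORS `tens P d` with `pevn (tens P d) w = eval (cum w) P` (`pevn_tens`). The
support-matching theorem of part `AllHHExact` becomes the matching hypothesis of the ray theorem at
a point of the pole hyperplane (`match_pole`, registered as `separateAllHH_forms`).
-/

noncomputable section

open Finset MvPolynomial

namespace Summit.KontsevichZagierPeriods.ArrangementNormalForm.JanusBands

namespace SepAll

variable {b n : ℕ}

/-! ### The literal forms over the base -/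

/-- The `x′`-part of a base point. -/
def pr (x : Fin (b + 1) → ℝ) : Fin b → ℝ := fun i => x (Fin.castSucc i)

/-- The pole coordinate. -/
def lam (l : Fin b → ℝ) (l₀ : ℝ) (x : Fin (b + 1) → ℝ) : ℝ :=
  x (Fin.last b) - (∑ i, l i * x (Fin.castSucc i) + l₀)

/-- The linear part of the pole coordinate. -/
def lamL (l : Fin b → ℝ) (v : Fin (b + 1) → ℝ) : ℝ := v (Fin.last b) - ∑ i, l i * v (Fin.castSucc i)

/-- The frame point with frame coordinates `s`. -/
def fpt (z₁ : Fin (b + 1) → ℝ) (f : Fin (b + 1) → Fin (b + 1) → ℝ) (s : Fin (b + 1) → ℝ) :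
    Fin (b + 1) → ℝ := z₁ + ∑ l', s l' • f l'

/-- Coordinates of the frame point. -/
theorem fpt_apply (z₁ : Fin (b + 1) → ℝ) (f : Fin (b + 1) → Fin (b + 1) → ℝ) (s : Fin (b + 1) → ℝ)
    (j : Fin (b + 1)) : fpt z₁ f s j = z₁ j + ∑ l', s l' * f l' j := by
  simp [fpt, Finset.sum_apply, smul_eq_mul]

/-- The pole coordinate of the frame point. -/
theorem lam_fpt (l : Fin b → ℝ) (l₀ : ℝ) (z₁ : Fin (b + 1) → ℝ) (f : Fin (b + 1) → Fin (b + 1) → ℝ)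
    (s : Fin (b + 1) → ℝ) : lam l l₀ (fpt z₁ f s) = lam l l₀ z₁ + ∑ l', s l' * lamL l (f l') := by
  have h1 : ∀ i : Fin b, l i * fpt z₁ f s (Fin.castSucc i) =
      l i * z₁ (Fin.castSucc i) + ∑ l', s l' * (l i * f l' (Fin.castSucc i)) := by
    intro i
    rw [fpt_apply, mul_add, Finset.mul_sum]
    congr 1
    refine Finset.sum_congr rfl fun l' _ => ?_
    ring
  unfold lam lamL
  rw [fpt_apply, Finset.sum_congr rfl fun i _ => h1 i, Finset.sum_add_distrib, Finset.sum_comm]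
  simp only [mul_sub, Finset.mul_sum, Finset.sum_sub_distrib]
  ring

/-- The `x′`-part of the frame point. -/
theorem pr_fpt (z₁ : Fin (b + 1) → ℝ) (f : Fin (b + 1) → Fin (b + 1) → ℝ) (s : Fin (b + 1) → ℝ)
    (k : Fin b) : pr (fpt z₁ f s) k = z₁ (Fin.castSucc k) + ∑ l', s l' * f l' (Fin.castSucc k) :=
  fpt_apply z₁ f s _

/-! ### The frame polynomials -/

/-- The affine substitution polynomials of the `x′`-coordinates (the level `l₀'` omitted). -/
def Asub (z₁ : Fin (b + 1) → ℝ) (f : Fin (b + 1) → Fin (b + 1) → ℝ) (l₀' : Fin (b + 1)) (k : Fin b) :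
    MvPolynomial (Fin (b + 1)) ℝ :=
  C (z₁ (Fin.castSucc k)) + ∑ l' ∈ univ.erase l₀', C (f l' (Fin.castSucc k)) * X l'

/-- The Taylor coefficient in frame coordinates. -/
def Kpoly (z₁ : Fin (b + 1) → ℝ) (f : Fin (b + 1) → Fin (b + 1) → ℝ) (l₀' : Fin (b + 1))
    (qi : MvPolynomial (Fin b) ℝ) : MvPolynomial (Fin (b + 1)) ℝ :=
  bind₁ (Asub z₁ f l₀') qi

/-- The pole coordinate in frame coordinates. -/
def Lpoly (l : Fin b → ℝ) (l₀ : ℝ) (z₁ : Fin (b + 1) → ℝ) (f : Fin (b + 1) → Fin (b + 1) → ℝ) :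
    MvPolynomial (Fin (b + 1)) ℝ :=
  C (lam l l₀ z₁) + ∑ l', C (lamL l (f l')) * X l'

/-- The `i`-th Taylor piece in frame coordinates. -/
def Gpiece (l : Fin b → ℝ) (l₀ : ℝ) (z₁ : Fin (b + 1) → ℝ) (f : Fin (b + 1) → Fin (b + 1) → ℝ)
    (l₀' : Fin (b + 1)) (q : ℕ → MvPolynomial (Fin b) ℝ) (i : ℕ) : MvPolynomial (Fin (b + 1)) ℝ :=
  Lpoly l l₀ z₁ f ^ i * Kpoly z₁ f l₀' (q i)

section Eval

variable (l : Fin b → ℝ) (l₀ : ℝ) (z₁ : Fin (b + 1) → ℝ) (f : Fin (b + 1) → Fin (b + 1) → ℝ)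
  {l₀' : Fin (b + 1)} (hf0 : ∀ k : Fin b, f l₀' (Fin.castSucc k) = 0)

include hf0 in
/-- Evaluating the substitution polynomials. -/
theorem eval_Asub (s : Fin (b + 1) → ℝ) (k : Fin b) :
    eval s (Asub z₁ f l₀' k) = pr (fpt z₁ f s) k := by
  rw [pr_fpt, Asub, map_add, eval_C, map_sum, ← Finset.sum_erase_add _ _ (Finset.mem_univ l₀'), hf0 k,
    mul_zero, add_zero]
  congr 1
  refine Finset.sum_congr rfl fun l' _ => ?_
  rw [map_mul, eval_C, eval_X, mul_comm]

include hf0 in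
/-- **Evaluating the Taylor coefficients.** -/
theorem eval_Kpoly (s : Fin (b + 1) → ℝ) (qi : MvPolynomial (Fin b) ℝ) :
    eval s (Kpoly z₁ f l₀' qi) = eval (pr (fpt z₁ f s)) qi := by
  unfold Kpoly
  show eval₂Hom (RingHom.id ℝ) s (bind₁ _ qi) = _
  rw [eval₂Hom_bind₁]
  show eval (fun k => eval s (Asub z₁ f l₀' k)) qi = _
  have : (fun k => eval s (Asub z₁ f l₀' k)) = pr (fpt z₁ f s) := funext fun k => eval_Asub z₁ f hf0 s k
  rw [this]

/-- Evaluating the pole polynomial. -/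
theorem eval_Lpoly (s : Fin (b + 1) → ℝ) : eval s (Lpoly l l₀ z₁ f) = lam l l₀ (fpt z₁ f s) := by
  rw [lam_fpt, Lpoly, map_add, eval_C, map_sum]
  congr 1
  refine Finset.sum_congr rfl fun l' _ => ?_
  rw [map_mul, eval_C, eval_X, mul_comm]

include hf0 in
/-- **Evaluating the Taylor pieces.** -/
theorem eval_Gpiece (q : ℕ → MvPolynomial (Fin b) ℝ) (s : Fin (b + 1) → ℝ) (i : ℕ) :
    eval s (Gpiece l l₀ z₁ f l₀' q i) = eval (pr (fpt z₁ f s)) (q i) * lam l l₀ (fpt z₁ f s) ^ i := by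
  rw [Gpiece, map_mul, map_pow, eval_Lpoly, eval_Kpoly z₁ f hf0, mul_comm]

end Eval

/-- **The Taylor coefficients do not involve the vertical variable.** -/
theorem support_Kpoly (z₁ : Fin (b + 1) → ℝ) (f : Fin (b + 1) → Fin (b + 1) → ℝ) (l₀' : Fin (b + 1))
    (qi : MvPolynomial (Fin b) ℝ) : ∀ d ∈ (Kpoly z₁ f l₀' qi).support, d l₀' = 0 := by
  classical
  intro d hd
  by_contra hne
  have hv : l₀' ∈ (Kpoly z₁ f l₀' qi).vars :=
    (mem_vars_iff_mem_support l₀').2 ⟨d, hd, Finsupp.mem_support_iff.2 hne⟩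
  have h1 := vars_bind₁ (Asub z₁ f l₀') qi hv
  obtain ⟨k, -, hk⟩ := Finset.mem_biUnion.1 h1
  have hA : (Asub z₁ f l₀' k).vars ⊆ univ.erase l₀' := by
    unfold Asub
    refine (vars_add_subset _ _).trans (Finset.union_subset (by rw [vars_C]; exact Finset.empty_subset _) ?_)
    refine (vars_sum_subset _ _).trans (Finset.biUnion_subset.2 fun l' hl' => ?_)
    refine (vars_mul _ _).trans (Finset.union_subset (by rw [vars_C]; exact Finset.empty_subset _) ?_)
    intro j hj
    rw [vars_X, Finset.mem_singleton] at hj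
    rw [hj]; exact hl'
  exact (Finset.ne_of_mem_erase (hA hk)) rfl

/-! ### Frame monomials along the sector: the exponent map -/

/-- The blown-up exponents of the frame monomial `s^γ` along the sector `s = cum w`. -/
def Mex (γ : Fin n →₀ ℕ) (j : Fin n) : ℕ := ∑ l', if j ≤ l' then γ l' else 0

/-- **Frame monomials along the sector are blown-up monomials.** -/
theorem prod_cum_pow (w : Fin n → ℝ) (γ : Fin n →₀ ℕ) :
    (∏ l', cum w l' ^ (γ l')) = mono (Mex γ) w := by
  unfold cum mono Mex
  simp_rw [← Finset.prod_pow]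
  rw [Finset.prod_comm]
  refine Finset.prod_congr rfl fun j _ => ?_
  rw [← Finset.prod_pow_eq_pow_sum]
  refine Finset.prod_congr rfl fun l' _ => ?_
  by_cases h : j ≤ l'
  · rw [if_pos h, if_pos h]
  · rw [if_neg h, if_neg h, one_pow, pow_zero]

/-- The blown-up exponents are bounded by the degree. -/
theorem Mex_le_degree (γ : Fin n →₀ ℕ) (j : Fin n) : Mex γ j ≤ γ.degree := by
  rw [Mex, Finsupp.degree_eq_sum]
  exact Finset.sum_le_sum fun l' _ => by split_ifs <;> simp

/-- The blown-up exponent as degree minus a prefix sum. -/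
theorem Mex_eq_degree_sub (γ : Fin n →₀ ℕ) (j : Fin n) :
    Mex γ j = γ.degree - ∑ l', if l' < j then γ l' else 0 := by
  have h : γ.degree = Mex γ j + ∑ l', if l' < j then γ l' else 0 := by
    rw [Mex, Finsupp.degree_eq_sum, ← Finset.sum_add_distrib]
    refine Finset.sum_congr rfl fun l' _ => ?_
    by_cases hl : j ≤ l'
    · rw [if_pos hl, if_neg (not_lt.2 hl), add_zero]
    · rw [if_neg hl, if_pos (lt_of_not_ge hl), zero_add]
  omega

/-- **Monomials of one class have the same loaded blown-up exponents.** -/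
theorem Mex_eq_of_class {γ γ' : Fin n →₀ ℕ} {jstar : Fin n} (hlow : ∀ l', l' < jstar → γ' l' = γ l')
    (hdeg : γ'.degree = γ.degree) {j : Fin n} (hj : j ≤ jstar) : Mex γ' j = Mex γ j := by
  rw [Mex_eq_degree_sub, Mex_eq_degree_sub, hdeg]
  congr 1
  refine Finset.sum_congr rfl fun l' _ => ?_
  split_ifs with h
  · exact hlow l' (lt_of_lt_of_le h hj)
  · rfl

/-- **The exponent map is injective.** -/
theorem Mex_injective {γ γ' : Fin n →₀ ℕ} (h : Mex γ = Mex γ') : γ = γ' := by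
  classical
  by_contra hne
  have hex : ∃ j, γ j ≠ γ' j := by
    by_contra hall
    push Not at hall
    exact hne (Finsupp.ext hall)
  set S : Finset (Fin n) := univ.filter fun j => γ j ≠ γ' j with hS
  have hSne : S.Nonempty := by
    obtain ⟨j, hj⟩ := hex
    exact ⟨j, Finset.mem_filter.2 ⟨Finset.mem_univ _, hj⟩⟩
  set j := S.max' hSne with hjdef
  have hjS : j ∈ S := Finset.max'_mem S hSne
  have hj : γ j ≠ γ' j := (Finset.mem_filter.1 hjS).2
  have habove : ∀ l', j < l' → γ l' = γ' l' := by
    intro l' hl'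
    by_contra hne'
    have : l' ∈ S := Finset.mem_filter.2 ⟨Finset.mem_univ _, hne'⟩
    exact absurd (Finset.le_max' S l' this) (not_le.2 (hjdef ▸ hl'))
  have e : ∀ μ : Fin n →₀ ℕ, Mex μ j = μ j + ∑ l', if j < l' then μ l' else 0 := by
    intro μ
    rw [Mex, ← Finset.sum_erase_add _ _ (Finset.mem_univ j), if_pos le_rfl, add_comm]
    congr 1
    rw [← Finset.sum_erase_add univ (fun l' => if j < l' then μ l' else 0) (Finset.mem_univ j),
      if_neg (lt_irrefl _), add_zero]
    refine Finset.sum_congr rfl fun l' hl' => ?_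
    have hne' : l' ≠ j := Finset.ne_of_mem_erase hl'
    by_cases h1 : j ≤ l'
    · rw [if_pos h1, if_pos (lt_of_le_of_ne h1 hne'.symm)]
    · rw [if_neg h1, if_neg (fun h2 => h1 h2.le)]
  have h1 := congrFun h j
  rw [e γ, e γ'] at h1
  have h2 : (∑ l', if j < l' then γ l' else 0) = ∑ l', if j < l' then γ' l' else 0 :=
    Finset.sum_congr rfl fun l' _ => by split_ifs with h3 <;> [rw [habove l' h3]; rfl]
  rw [h2] at h1
  exact hj (Nat.add_right_cancel h1)

/-! ### Coefficient tensors -/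

/-- Truncating exponents to a box. -/
def trunc (d : ℕ) (v : Fin n → ℕ) : Fin n → Fin (d + 1) := fun j => ⟨min (v j) d, by omega⟩

/-- Truncation is the identity on bounded exponents. -/
theorem trunc_coe {d : ℕ} {v : Fin n → ℕ} (hv : ∀ j, v j ≤ d) (j : Fin n) : (trunc d v j : ℕ) = v j := by
  simp [trunc, hv j]

/-- The coefficient tensor of a frame polynomial along the sector. -/
def tens (P : MvPolynomial (Fin n) ℝ) (d : ℕ) : (Fin n → Fin (d + 1)) → ℝ :=
  fun e => ∑ γ ∈ P.support with trunc d (Mex γ) = e, coeff γ P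

/-- Exponents of a polynomial are bounded by its total degree. -/
theorem Mex_le_of_mem {P : MvPolynomial (Fin n) ℝ} {d : ℕ} (hP : P.totalDegree ≤ d)
    {γ : Fin n →₀ ℕ} (hγ : γ ∈ P.support) (j : Fin n) : Mex γ j ≤ d := by
  refine (Mex_le_degree γ j).trans (le_trans ?_ hP)
  have := le_totalDegree hγ
  rwa [Finsupp.degree]

/-- **The tensor evaluates to the polynomial along the sector.** -/
theorem pevn_tens {P : MvPolynomial (Fin n) ℝ} {d : ℕ} (hP : P.totalDegree ≤ d) (w : Fin n → ℝ) :
    pevn (tens P d) w = eval (fun l' => cum w l') P := by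
  classical
  rw [eval_eq', pevn]
  have key : ∀ e : Fin n → Fin (d + 1), tens P d e * mono (fun l' => (e l' : ℕ)) w =
      ∑ γ ∈ P.support with trunc d (Mex γ) = e,
        coeff γ P * mono (fun l' => ((trunc d (Mex γ) l' : ℕ))) w := by
    intro e
    rw [tens, Finset.sum_mul]
    refine Finset.sum_congr rfl fun γ hγ => ?_
    rw [(Finset.mem_filter.1 hγ).2]
  simp_rw [key]
  rw [Finset.sum_fiberwise_of_maps_to (fun γ _ => Finset.mem_univ _)]
  refine Finset.sum_congr rfl fun γ hγ => ?_
  rw [prod_cum_pow]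
  congr 2
  funext j
  exact trunc_coe (Mex_le_of_mem hP hγ) j

/-- A non-zero tensor entry comes from a monomial. -/
theorem exists_of_tens_ne_zero {P : MvPolynomial (Fin n) ℝ} {d : ℕ} {e : Fin n → Fin (d + 1)}
    (he : tens P d e ≠ 0) : ∃ γ ∈ P.support, trunc d (Mex γ) = e := by
  classical
  by_contra h
  push Not at h
  refine he (Finset.sum_eq_zero fun γ hγ => ?_)
  rw [Finset.mem_filter] at hγ
  exact absurd hγ.2 (h γ hγ.1)

/-- **A monomial gives a non-zero tensor entry.** -/
theorem tens_trunc_ne_zero {P : MvPolynomial (Fin n) ℝ} {d : ℕ} (hP : P.totalDegree ≤ d)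
    {γ : Fin n →₀ ℕ} (hγ : γ ∈ P.support) : tens P d (trunc d (Mex γ)) ≠ 0 := by
  classical
  unfold tens
  have hmem : γ ∈ P.support.filter (fun γ' => trunc d (Mex γ') = trunc d (Mex γ)) :=
    Finset.mem_filter.2 ⟨hγ, rfl⟩
  rw [Finset.sum_eq_single_of_mem γ hmem]
  · exact mem_support_iff.1 hγ
  · intro γ' hγ' hne
    rw [Finset.mem_filter] at hγ'
    exfalso
    refine hne (Mex_injective (funext fun j => ?_))
    have h1 := congrArg (fun v : Fin n → Fin (d + 1) => (v j : ℕ)) hγ'.2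
    rwa [trunc_coe (Mex_le_of_mem hP hγ'.1), trunc_coe (Mex_le_of_mem hP hγ)] at h1

/-! ### Matching at a point of the pole hyperplane -/

/-- At a point of the pole hyperplane the pole polynomial is the linear pole coordinate. -/
theorem Lpoly_eq_lamP (l : Fin b → ℝ) (l₀ : ℝ) {z₁ : Fin (b + 1) → ℝ} (hlam : lam l l₀ z₁ = 0)
    (f : Fin (b + 1) → Fin (b + 1) → ℝ) : Lpoly l l₀ z₁ f = lamP fun l' => lamL l (f l') := by
  rw [Lpoly, hlam, C_0, zero_add]

/-- **The matching hypothesis of the ray theorem at a point of the pole hyperplane.** -/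
theorem match_pole (l : Fin b → ℝ) (l₀ : ℝ) (z₁ : Fin (b + 1) → ℝ) (f : Fin (b + 1) → Fin (b + 1) → ℝ)
    (l₀' jstar : Fin (b + 1)) (hlam : lam l l₀ z₁ = 0) (hlow : ∀ l', l' < jstar → lamL l (f l') = 0)
    (hal₀ : lamL l (f l₀') ≠ 0) (N : ℕ) (q : ℕ → MvPolynomial (Fin b) ℝ) (d : ℕ)
    (hd : (∑ i ∈ range N, Gpiece l l₀ z₁ f l₀' q i).totalDegree ≤ d)
    (hdi : ∀ i, i < N → (Gpiece l l₀ z₁ f l₀' q i).totalDegree ≤ d)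
    {i : ℕ} (hi : i < N) {e : Fin (b + 1) → Fin (d + 1)} (he : tens (Gpiece l l₀ z₁ f l₀' q i) d e ≠ 0) :
    ∃ e', tens (∑ i' ∈ range N, Gpiece l l₀ z₁ f l₀' q i') d e' ≠ 0 ∧
      ∀ j, j ≤ jstar → (e' j : ℕ) = e j := by
  obtain ⟨γ, hγ, hγe⟩ := exists_of_tens_ne_zero he
  have hG : ∀ i', Gpiece l l₀ z₁ f l₀' q i' =
      lamP (fun l' => lamL l (f l')) ^ i' * Kpoly z₁ f l₀' (q i') := fun i' => by
    rw [Gpiece, Lpoly_eq_lamP l l₀ hlam]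
  rw [hG i] at hγ
  obtain ⟨γ', hγ', hlow', hdeg⟩ := exact_support jstar l₀' (fun l' => lamL l (f l')) hlow hal₀ N
    (fun i' => Kpoly z₁ f l₀' (q i')) (fun i' => support_Kpoly z₁ f l₀' (q i')) hi hγ
  have htot : (∑ i' ∈ range N, lamP (fun l' => lamL l (f l')) ^ i' * Kpoly z₁ f l₀' (q i')) =
      ∑ i' ∈ range N, Gpiece l l₀ z₁ f l₀' q i' := Finset.sum_congr rfl fun i' _ => (hG i').symm
  rw [htot] at hγ'
  refine ⟨trunc d (Mex γ'), tens_trunc_ne_zero hd hγ', fun j hj => ?_⟩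
  have hbi : ((lamP fun l' => lamL l (f l')) ^ i * Kpoly z₁ f l₀' (q i)).totalDegree ≤ d :=
    hG i ▸ hdi i hi
  rw [← hγe, trunc_coe (Mex_le_of_mem hd hγ'), trunc_coe (Mex_le_of_mem hbi hγ)]
  exact Mex_eq_of_class hlow' hdeg hj

end SepAll

/-- **The matching hypothesis of the ray theorem at a point of the pole hyperplane** (registered
part of `stub_separateHigh_hH`; literal form of `SepAll.match_pole`): along a frame containing a
vertical vector `f l₀'`, with the pole level `j⋆`, every non-zero entry of the coefficient tensor
of a Taylor piece is matched by a non-zero entry of the tensor of the total numerator with the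
same blown-up exponents at the levels `≤ j⋆`. -/
theorem separateAllHH_forms (b : ℕ) (l : Fin b → ℝ) (l₀ : ℝ) (z₁ : Fin (b + 1) → ℝ) (f : Fin (b + 1) → Fin (b + 1) → ℝ) (l₀' jstar : Fin (b + 1)) (hlam : SepAll.lam l l₀ z₁ = 0) (hlow : ∀ l', l' < jstar → SepAll.lamL l (f l') = 0) (hal₀ : SepAll.lamL l (f l₀') ≠ 0) (N : ℕ) (q : ℕ → MvPolynomial (Fin b) ℝ) (d : ℕ) (hd : (∑ i ∈ Finset.range N, SepAll.Gpiece l l₀ z₁ f l₀' q i).totalDegree ≤ d) (hdi : ∀ i, i < N → (SepAll.Gpiece l l₀ z₁ f l₀' q i).totalDegree ≤ d) (i : ℕ) (hi : i < N) (e : Fin (b + 1) → Fin (d + 1)) (he : SepAll.tens (SepAll.Gpiece l l₀ z₁ f l₀' q i) d e ≠ 0) : ∃ e', SepAll.tens (∑ i' ∈ Finset.range N, SepAll.Gpiece l l₀ z₁ f l₀' q i') d e' ≠ 0 ∧ ∀ j, j ≤ jstar → (e' j : ℕ) = e j := by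
  exact SepAll.match_pole l l₀ z₁ f l₀' jstar hlam hlow hal₀ N q d hd hdi hi he

end Summit.KontsevichZagierPeriods.ArrangementNormalForm.JanusBands
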